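import Summits.NavierStokesRegularity.NavierStokesRegularity.Theorems.TypeICertificateLadderRungReynoldsOneTaoCover
import Summits.NavierStokesRegularity.NavierStokesRegularity.Theorems.ProductionEfficiencyDecay.Negative.ProductionEfficiencyDecayFalseOfDssLerayHopfBlowup
import Literature.Analysis.FluidPDE.NSCriticalClosure
import Literature.Analysis.FluidPDE.NSCriticalClosureReduced
import Literature.Analysis.FluidPDE.NSCriticalClosureTao
import Literature.Analysis.FluidPDE.NSCriticalClosureHolds
import Literature.Analysis.FluidPDE.TsaiLocalEnergyScaling
import Literature.Analysis.FluidPDE.TaoLocalisation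
import Literature.Analysis.FluidPDE.SelfSimilar
import HarnessLib

/-!
# Crux `EfficiencyFloor.ProductionEfficiencyDecay` (stmt-NavierStokesRegularity-22866), skeleton stub
# `stub_dssStratumRung` (BC5 rung, S4) — PROVED: no exactly discretely self-similar Leray–Hopf blow-up exists,
# by the tree's discharged `L^∞_t L³_x` continuation criterion

`--supports stmt-NavierStokesRegularity-22866` (line `efficiency_floor`; seat ns-ef-p3; the scaling argument and the
theorem `not_dssLerayHopfBlowup_of_L3criterion` are ADAPTED VERBATIM from the evidence file
`lineH/DssLerayHopfBlowupExcludedByL3.lean` attached to stmt-22866 by planner-ns-idea-5-g2 (2026-08-28T00:47Z), who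
cannot write under `Theorems/`; this file adds the observation that the criterion is DISCHARGED in the tree and lands
the registered stub by name).

THE ARGUMENT (planner ns-idea-5 g2). `ProductionEfficiencyDecayNegative.DssLerayHopfBlowup` (the hypothesis of the
lead's negative lemma p585341, verbatim the hypotheses of the BC5 rung) asks for a maximal smooth solution on
`ℝ³ × [0,T)`, Leray–Hopf from a rapidly decaying datum, discretely self-similar about `(T,0)` GLOBALLY IN SPACE:
`c·u(T + c²s, c x) = u(T + s, x)`. The `L³(ℝ³)` norm is invariant under this scaling, so `‖u(t)‖₃` takes the same
values along every DSS orbit `t_k = T − c^{−2k}τ₀` (`lintegral_cube_dss_iterate`); on the closed sub-slab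
`[0, T(1−c⁻²)]` the solution is bounded with finite energy (Tao's class, `RungReynoldsOne.stub_taoCover`), hence
`sup_{[0,T)} ‖u(t)‖₃ < ∞`, and the `L^∞_t L³_x` criterion `hasSmoothExtensionPast_of_eLpNorm_three_bounded`
(Escauriaza–Seregin–Šverák 2003 Thms 1.3–1.4 / Seregin 2012 Thm 1.1) continues the solution past `T` — contradicting
maximality (`not_dssLerayHopfBlowup_of_L3criterion`).

THE LANDING (this seat). The criterion is a THEOREM of the tree (`hasSmoothExtensionPast_of_eLpNorm_three_bounded_holds`,
`NSCriticalClosureHolds.lean`), so `¬ DssLerayHopfBlowup` holds outright (`not_dssLerayHopfBlowup`), and by the lead's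
equivalence `dssStratumRung_iff_not_DssLerayHopfBlowup` (p586369) the registered stub `stub_dssStratumRung` is PROVED
(signature verbatim, vacuously: its hypothesis class is empty). Consequences for the line: (i) the skeleton's only
open stub is now S2 = `stub_depletionGivenBudget`, the crux proper; (ii) the route's `why it might fail` object —
"a discretely self-similar Type-I blow-up … has mean efficiency ≍ c > 0" — is NOT the exactly-DSS maximal solution of
this class (there is none) but a LOCALLY DSS blow-up (|y|⁻¹-tailed profile glued to a finite-energy exterior, with
`‖u(t)‖₃ → ∞`), on which nothing here bites.

HONEST FRAMING: an exclusion of one degenerate blow-up geometry by a known regularity criterion; the crux stmt-22866,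
the residual stmt-1574 and NS regularity all stay open; no summit is proved.
[cite: EscauriazaSereginSverak2003, Thms 1.3–1.4; Seregin2012CMP, Thm 1.1]
-/

-- the problem directory repeats the summit name (`NavierStokesRegularity/NavierStokesRegularity`)
set_option linter.dupNamespace false

noncomputable section

open Set MeasureTheory
open scoped ENNReal NNReal
open Literature.Analysis.FluidPDE

namespace Summit.NavierStokesRegularity.NavierStokesRegularity.Theorems

namespace ProductionEfficiencyDecay

open Summit.NavierStokesRegularity.NavierStokesRegularity.Theorems.RungReynoldsOne (stub_taoCover)
open Summit.NavierStokesRegularity.NavierStokesRegularity.Theorems.ProductionEfficiencyDecayNegative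
  (DssLerayHopfBlowup dssStratumRung_iff_not_DssLerayHopfBlowup)

/-- **`L³` cube is constant along DSS orbits**: if `w` is `c`-DSS (`c > 0`), then
`∫|w(−τ₀ (c²)⁻¹^k)|³ = ∫|w(−τ₀)|³`. (Adapted verbatim from planner-ns-idea-5-g2's evidence file.) [folklore] -/
theorem lintegral_cube_dss_iterate {c : ℝ} (hc : 0 < c)
    {w : ℝ → EuclideanSpace ℝ (Fin 3) → EuclideanSpace ℝ (Fin 3)} (hw : IsDiscretelySelfSimilar c w)
    (τ₀ : ℝ) (k : ℕ) :
    ∫⁻ x, ‖w (-τ₀ * (c ^ 2)⁻¹ ^ k) x‖ₑ ^ 3 = ∫⁻ x, ‖w (-τ₀) x‖ₑ ^ 3 := by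
  have hstep : ∀ s : ℝ, ∫⁻ x, ‖w s x‖ₑ ^ 3 = ∫⁻ x, ‖w (c ^ 2 * s) x‖ₑ ^ 3 := by
    intro s
    have hws : ∀ x, w s x = c • w (c ^ 2 * s) (c • x) := fun x => by
      have h := congrFun (congrFun hw s) x
      rw [nsRescale_apply] at h
      exact h.symm
    have hc3 : ‖c‖ₑ ^ 3 = ENNReal.ofReal (c ^ 3) := by
      rw [Real.enorm_eq_ofReal_abs, ← ENNReal.ofReal_pow (abs_nonneg c), abs_of_pos hc]
    calc ∫⁻ x, ‖w s x‖ₑ ^ 3 = ∫⁻ x, ‖c‖ₑ ^ 3 * ‖w (c ^ 2 * s) (c • x)‖ₑ ^ 3 :=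
          lintegral_congr fun x => by rw [hws x, enorm_smul, mul_pow]
      _ = ‖c‖ₑ ^ 3 * ∫⁻ x, ‖w (c ^ 2 * s) (c • x)‖ₑ ^ 3 :=
          lintegral_const_mul' _ _ (by simp)
      _ = ‖c‖ₑ ^ 3 * (ENNReal.ofReal ((c ^ 3)⁻¹) * ∫⁻ y, ‖w (c ^ 2 * s) y‖ₑ ^ 3) := by
          rw [lintegral_comp_smul_fin3 (fun y => ‖w (c ^ 2 * s) y‖ₑ ^ 3) hc]
      _ = ∫⁻ y, ‖w (c ^ 2 * s) y‖ₑ ^ 3 := by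
          rw [← mul_assoc, hc3, ← ENNReal.ofReal_mul (by positivity),
            mul_inv_cancel₀ (by positivity), ENNReal.ofReal_one, one_mul]
  induction k with
  | zero => simp
  | succ k ih =>
      rw [← ih, hstep (-τ₀ * (c ^ 2)⁻¹ ^ (k + 1))]
      have h0 : c ^ 2 ≠ 0 := by positivity
      have : c ^ 2 * (-τ₀ * (c ^ 2)⁻¹ ^ (k + 1)) = -τ₀ * (c ^ 2)⁻¹ ^ k := by
        rw [pow_succ, inv_pow, inv_pow]
        field_simp
        ring
      rw [this]

/-- **Exact DSS Leray–Hopf blow-up is excluded by the `L^∞_t L³_x` criterion** (as a hypothesis): `L³` is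
scale-invariant, so a DSS maximal solution has `sup_{[0,T)} ‖u(t)‖₃ < ∞` (bounded on one period by Tao's class,
propagated along DSS orbits) and the criterion extends it past `T`, against maximality. (Adapted verbatim from
planner-ns-idea-5-g2's evidence file.) [cite: EscauriazaSereginSverak2003, Thms 1.3–1.4] -/
theorem not_dssLerayHopfBlowup_of_L3criterion
    (hL3 : hasSmoothExtensionPast_of_eLpNorm_three_bounded) : ¬ DssLerayHopfBlowup := by
  rintro ⟨ν, T, u, p, hν, hT, hmax, hLH, hdec, c, hc, hdss⟩
  have hc0 : 0 < c := lt_trans zero_lt_one hc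
  have hy1 : 1 < c ^ 2 := by nlinarith
  have hy0 : 0 < c ^ 2 := by positivity
  -- the closed sub-slab `[0, T']`, `T' = T (1 - c⁻²)`
  set T' : ℝ := T - T / c ^ 2 with hT'def
  have hT'pos : 0 < T' := by
    rw [hT'def]
    have : T / c ^ 2 < T := by rw [div_lt_iff₀ hy0]; nlinarith
    linarith
  have hT'lt : T' < T := by
    rw [hT'def]; have : 0 < T / c ^ 2 := by positivity
    linarith
  obtain ⟨q, hcl, hB, -, -⟩ := stub_taoCover hν hT hmax.1 hLH hdec (T' := T') ⟨hT'pos, hT'lt⟩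
  obtain ⟨B₀, hB₀0, hB₀⟩ := exists_forall_norm_le_of_hasBoundedSobolevNormsOn hcl hB
  -- uniform cube bound on the sub-slab: `∫|u|³ ≤ B₀ · 2E₀`
  set E2 : ℝ≥0∞ := ENNReal.ofReal (2 * VectorCalculus.kineticEnergy (u 0)) with hE2
  set J : ℝ≥0∞ := ENNReal.ofReal B₀ * E2 with hJdef
  have hJtop : J ≠ ⊤ := ENNReal.mul_ne_top ENNReal.ofReal_ne_top ENNReal.ofReal_ne_top
  have hcube : ∀ s ∈ Icc 0 T', ∫⁻ x, ‖u s x‖ₑ ^ 3 ≤ J := by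
    intro s hs
    have hsT : s ∈ Icc 0 T := ⟨hs.1, hs.2.trans hT'lt.le⟩
    calc ∫⁻ x, ‖u s x‖ₑ ^ 3 ≤ ∫⁻ x, ENNReal.ofReal B₀ * ‖u s x‖ₑ ^ 2 := by
          refine lintegral_mono fun x => ?_
          rw [pow_succ', sq]
          refine mul_le_mul_left ?_ _
          rw [← ofReal_norm]
          exact ENNReal.ofReal_le_ofReal (hB₀ s hs x)
      _ = ENNReal.ofReal B₀ * ∫⁻ x, ‖u s x‖ₑ ^ 2 := lintegral_const_mul' _ _ ENNReal.ofReal_ne_top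
      _ ≤ J := by rw [hJdef]; exact mul_le_mul_right (hLH.lintegral_enorm_sq_le hν.le hsT) _
  -- the cube bound propagates to all of `[0,T)` along DSS orbits
  have hall : ∀ t ∈ Ico 0 T, ∫⁻ x, ‖u t x‖ₑ ^ 3 ≤ J := by
    intro t ht
    by_cases hcase : t ≤ T'
    · exact hcube t ⟨ht.1, hcase⟩
    push Not at hcase
    have hτ : 0 < T - t := by linarith [ht.2]
    set τ : ℝ := T - t with hτdef
    have hx1 : 1 ≤ T / τ := by rw [le_div_iff₀ hτ]; linarith [ht.1]
    obtain ⟨n, hn1, hn2⟩ := exists_nat_pow_near hx1 hy1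
    set τ₀ : ℝ := (c ^ 2) ^ n * τ with hτ₀def
    have hτ₀leT : τ₀ ≤ T := by rw [hτ₀def]; rwa [le_div_iff₀ hτ] at hn1
    have hτ₀gt : T / c ^ 2 < τ₀ := by
      rw [div_lt_iff₀ hy0, hτ₀def]
      rw [div_lt_iff₀ hτ, pow_succ] at hn2
      nlinarith
    have hs0 : T - τ₀ ∈ Icc 0 T' := ⟨by linarith, by rw [hT'def]; linarith⟩
    have hiter := lintegral_cube_dss_iterate hc0 hdss τ₀ n
    have harg : T + -τ₀ * (c ^ 2)⁻¹ ^ n = t := by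
      rw [hτ₀def, hτdef, inv_pow]; field_simp; ring
    have harg0 : T + -τ₀ = T - τ₀ := by ring
    simp only [harg, harg0] at hiter
    rw [hiter]
    exact hcube _ hs0
  -- hence `sup_{[0,T)} ‖u(t)‖₃ < ∞`
  have h3 : ∀ t ∈ Ico 0 T, eLpNorm (u t) 3 volume ≤ J ^ (1 / 3 : ℝ) := by
    intro t ht
    rw [eLpNorm_eq_lintegral_rpow_enorm_toReal (by norm_num : (3 : ℝ≥0∞) ≠ 0) (by norm_num),
      ENNReal.toReal_ofNat]
    refine ENNReal.rpow_le_rpow ?_ (by norm_num)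
    refine le_trans (le_of_eq (lintegral_congr fun x => ?_)) (hall t ht)
    rw [← ENNReal.rpow_natCast]; norm_num
  have hsup : (⨆ t ∈ Ico 0 T, eLpNorm (u t) 3 volume) < ⊤ := by
    refine lt_of_le_of_lt (iSup₂_le h3) ?_
    exact ENNReal.rpow_lt_top_of_nonneg (by norm_num) hJtop
  exact hmax.2 (hL3 ν T hν hT u p hmax.1 hLH hdec hsup)

/-- **No exactly discretely self-similar Leray–Hopf blow-up exists** — unconditionally: the `L^∞_t L³_x`
continuation criterion is discharged in the tree (`hasSmoothExtensionPast_of_eLpNorm_three_bounded_holds`,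
Seregin 2012 Thm 1.1 / ESS 2003). [cite: Seregin2012CMP, Thm 1.1] -/
theorem not_dssLerayHopfBlowup : ¬ DssLerayHopfBlowup :=
  not_dssLerayHopfBlowup_of_L3criterion hasSmoothExtensionPast_of_eLpNorm_three_bounded_holds

/-- **S4 — the registered BC5 rung `stub_dssStratumRung` of the crux skeleton of stmt-22866, PROVED (signature
verbatim).** The every-subwindow efficiency law on the exactly-DSS stratum of maximal smooth Leray–Hopf
rapidly-decaying-datum solutions holds because that stratum is EMPTY (`not_dssLerayHopfBlowup`), through the lead's
equivalence `dssStratumRung_iff_not_DssLerayHopfBlowup`. Vacuous truth about a class with no members; the crux itself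
is untouched. [cite: Seregin2012CMP, Thm 1.1] -/
theorem stub_dssStratumRung : ∀ (ν T : ℝ), 0 < ν → 0 < T → ∀ (u : ℝ → EuclideanSpace ℝ (Fin 3) → EuclideanSpace ℝ (Fin 3)) (p : ℝ → EuclideanSpace ℝ (Fin 3) → ℝ), Literature.Analysis.FluidPDE.IsMaximalSmoothSolution ν 0 u p T → Literature.Analysis.FluidPDE.IsLerayHopfOn T ν 0 (u 0) u → Literature.Analysis.FluidPDE.HasRapidSpatialDecay (u 0) → (∃ c : ℝ, 1 < c ∧ Literature.Analysis.FluidPDE.IsDiscretelySelfSimilar c (fun s x => u (T + s) x)) → ∀ ε : ℝ, 0 < ε → ∃ t₁ ∈ Set.Ico 0 T, (∀ t ∈ Set.Ico t₁ T, 0 < ∫⁻ x, ‖Literature.Analysis.FluidPDE.curl (u t) x‖ₑ ^ 2 ∧ ∫⁻ x, ‖Literature.Analysis.FluidPDE.curl (u t) x‖ₑ ^ 2 < ⊤) ∧ ∀ s t : ℝ, t₁ ≤ s → s ≤ t → t < T → ((∫⁻ x, ‖Literature.Analysis.FluidPDE.curl (u s) x‖ₑ ^ 2).toReal)⁻¹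 ^ 2 - ((∫⁻ x, ‖Literature.Analysis.FluidPDE.curl (u t) x‖ₑ ^ 2).toReal)⁻¹ ^ 2 ≤ ε * (t - s) :=
  dssStratumRung_iff_not_DssLerayHopfBlowup.2 not_dssLerayHopfBlowup

/-- **The DSS hypothesis is absurd for every single solution of the class** (pointwise form, convenient for callers):
a maximal smooth Leray–Hopf rapidly-decaying-datum solution is not `c`-DSS about `(T,0)` for any `c > 1`.
[cite: Seregin2012CMP, Thm 1.1] -/
theorem not_isDiscretelySelfSimilar_of_maximal {ν T : ℝ} (hν : 0 < ν) (hT : 0 < T)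
    {u : ℝ → EuclideanSpace ℝ (Fin 3) → EuclideanSpace ℝ (Fin 3)} {p : ℝ → EuclideanSpace ℝ (Fin 3) → ℝ}
    (hmax : IsMaximalSmoothSolution ν 0 u p T) (hLH : IsLerayHopfOn T ν 0 (u 0) u)
    (hdec : HasRapidSpatialDecay (u 0)) {c : ℝ} (hc : 1 < c) :
    ¬ IsDiscretelySelfSimilar c (fun s x => u (T + s) x) := fun hdss =>
  not_dssLerayHopfBlowup ⟨ν, T, u, p, hν, hT, hmax, hLH, hdec, c, hc, hdss⟩

end ProductionEfficiencyDecay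

end Summit.NavierStokesRegularity.NavierStokesRegularity.Theorems

end
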